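import Summits.KontsevichZagierPeriods.KontsevichZagierPeriods.Theorems.SoloInformedDefMoveIntegrandAdd
import HarnessLib

/-!
# Generator definability II: the domain-additivity move (1a)

Every bounded domain-additivity move of `KZ_ℝ` satisfies the definability invariant:
`soloInformed_definableRel_of_mem_bddDomainAddRel :
  ∀ c ∈ soloInformedBddDomainAddRel ℝ, SoloInformedDefinableRel c`.
This discharges the second of the four hypotheses of the kernel THEOREM R / THEOREM T for
bounded chains (`soloInformed_realParameterBarrier_bdd`, `soloInformed_realParameterTransfer_bdd`).

The one non-algebraic side condition of the move, `volume (D₁ ∩ D₂) = 0`, is first order on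
semialgebraic fibres: it says the fibre `D₁ ∩ D₂` has EMPTY INTERIOR (`soloInformedThin`, two
quantifier blocks; `soloInformed_volume_eq_zero_of_interior_eq_empty`). The remaining clauses are
admissibility, `D = D₁ ∪ D₂`, and agreement of the graphs over `D₁` and over `D₂`.

References: [cite: KontsevichZagier2001, §1.2 rule (1)]; [cite: BochnakCosteRoy1998, Prop. 2.2.4,
§2.8].
-/

noncomputable section

open Set MeasureTheory MvPolynomial Literature.ModelTheory.ExponentialFields
  Literature.NumberTheory.Transcendental

namespace Summit.KontsevichZagierPeriods.KontsevichZagierPeriods.Theorems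

namespace SoloInformedPTerm

variable {K : Type} {d : ℕ}

/-! ### The union clause `D = D₁ ∪ D₂` -/

/-- `{p | T.fibre p = U₁.fibre p ∪ U₂.fibre p}` is `ℚ`-semialgebraic.
[cite: BochnakCosteRoy1998, Prop. 2.2.4] -/
theorem isSemialgebraic_setOf_fibre_eq_union [Finite K] (T U₁ U₂ : SoloInformedPTerm K d) :
    IsSemialgebraic ℚ {p : K → ℝ | T.fibre p = U₁.fibre p ∪ U₂.fibre p} := by
  have hset : {p : K → ℝ | T.fibre p = U₁.fibre p ∪ U₂.fibre p} =
      {p | ∀ x, x ∈ T.fibre p ↔ x ∈ U₁.fibre p ∨ x ∈ U₂.fibre p} := by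
    ext p
    simp only [mem_setOf_eq, Set.ext_iff, mem_union]
  rw [hset]
  exact soloInformed_isSemialgebraic_setOf_forall_fibre
    (T := {w | w ∈ T.S ↔ w ∈ U₁.S ∨ w ∈ U₂.S})
    (soloInformed_isSemialgebraic_setOf_iff T.hS
      (soloInformed_isSemialgebraic_setOf_or U₁.hS U₂.hS))
    fun p x => Iff.rfl

/-! ### The graph-agreement clause over a sub-fibre -/

/-- The graphs of `T` and `U` agree over the fibre of `U`, in block form.
[cite: KontsevichZagier2001, §1.2 rule (1)] -/
def SoloInformedSubClause (T U : SoloInformedPTerm K d) (p : K → ℝ) : Prop :=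
  ∀ (x : Fin d → ℝ) (w : Fin 2 → ℝ), x ∈ U.fibre p → Fin.snoc x (w 0) ∈ T.gfibre p →
    Fin.snoc x (w 1) ∈ U.gfibre p → w 0 = w 1

/-- The graph-agreement clause is `ℚ`-semialgebraic in the parameter.
[cite: BochnakCosteRoy1998, Prop. 2.2.4] -/
theorem isSemialgebraic_setOf_subClause [Finite K] (T U : SoloInformedPTerm K d) :
    IsSemialgebraic ℚ {p : K → ℝ | SoloInformedSubClause T U p} := by
  have hC : IsSemialgebraic ℚ {u : (K ⊕ Fin d) ⊕ Fin 2 → ℝ | u ∘ Sum.inl ∈ U.S →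
      u ∘ soloSnocIdx K d 2 0 ∈ T.G → u ∘ soloSnocIdx K d 2 1 ∈ U.G →
        u (Sum.inr 0) = u (Sum.inr 1)} :=
    soloInformed_isSemialgebraic_setOf_imp (U.hS.preimage_comp _)
      (soloInformed_isSemialgebraic_setOf_imp (T.hG.preimage_comp _)
        (soloInformed_isSemialgebraic_setOf_imp (U.hG.preimage_comp _)
          (soloInformed_isSemialgebraic_setOf_coord_eq _ _)))
  refine soloInformed_isSemialgebraic_setOf_forall_fibre
    (soloInformed_isSemialgebraic_setOf_forall_block hC fun _ => Iff.rfl) fun p x => ?_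
  simp only [mem_setOf_eq, Sum.elim_comp_inl, comp_snocIdx_mem_iff, Sum.elim_inr, mem_fibre]

/-- Semantics of the graph-agreement clause. [cite: KontsevichZagier2001, §1.2 rule (1)] -/
theorem gval_eq_of_subClause {T U : SoloInformedPTerm K d} {p : K → ℝ}
    (h : SoloInformedSubClause T U p) (hT : T.SoloInformedFunctional p)
    (hU : U.SoloInformedFunctional p) {x : Fin d → ℝ} (hxT : x ∈ T.fibre p)
    (hxU : x ∈ U.fibre p) : T.gval p x = U.gval p x := by
  have := h x ![T.gval p x, U.gval p x] hxU (by simpa using snoc_gval_mem hT hxT)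
    (by simpa using snoc_gval_mem hU hxU)
  simpa using this

/-- The graph-agreement clause holds when both graphs over the fibre of `U` are graphs of
functions agreeing there. [cite: KontsevichZagier2001, §1.2 rule (1)] -/
theorem subClause_of_graphs {T U : SoloInformedPTerm K d} {p : K → ℝ}
    {g gU : (Fin d → ℝ) → ℝ} (hg : ∀ x ∈ U.fibre p, ∀ t, Fin.snoc x t ∈ T.gfibre p ↔ t = g x)
    (hgU : ∀ x ∈ U.fibre p, ∀ t, Fin.snoc x t ∈ U.gfibre p ↔ t = gU x)
    (heq : ∀ x ∈ U.fibre p, g x = gU x) : SoloInformedSubClause T U p := by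
  intro x w hx h0 h1
  rw [(hg x hx _).1 h0, (hgU x hx _).1 h1]
  exact heq x hx

/-! ### The null-overlap clause `volume (D₁ ∩ D₂) = 0` -/

/-- The fibres of `U₁` and `U₂` meet in a set with empty interior (`soloInformedThin`).
[cite: BochnakCosteRoy1998, §2.8] -/
def SoloInformedThinPair (U₁ U₂ : SoloInformedPTerm K d) (p : K → ℝ) : Prop :=
  soloInformedThin (U₁.S ∩ U₂.S) p

/-- The null-overlap clause is `ℚ`-semialgebraic in the parameter.
[cite: BochnakCosteRoy1998, Prop. 2.2.4] -/
theorem isSemialgebraic_setOf_thinPair [Finite K] (U₁ U₂ : SoloInformedPTerm K d) :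
    IsSemialgebraic ℚ {p : K → ℝ | SoloInformedThinPair U₁ U₂ p} :=
  soloInformed_isSemialgebraic_setOf_thin (U₁.hS.inter U₂.hS)

/-- The null-overlap clause says the overlap has empty interior. [folklore] -/
theorem thinPair_iff {U₁ U₂ : SoloInformedPTerm K d} {p : K → ℝ} :
    SoloInformedThinPair U₁ U₂ p ↔ interior (U₁.fibre p ∩ U₂.fibre p) = ∅ :=
  soloInformed_thin_iff_interior_eq_empty

/-- **The overlap of the fibres is null iff it has empty interior** (semialgebraic sets).
[cite: BochnakCosteRoy1998, §2.8] -/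
theorem thinPair_iff_volume_eq_zero {U₁ U₂ : SoloInformedPTerm K d} {p : K → ℝ} :
    SoloInformedThinPair U₁ U₂ p ↔ volume (U₁.fibre p ∩ U₂.fibre p) = 0 := by
  rw [thinPair_iff]
  refine ⟨fun h => soloInformed_volume_eq_zero_of_interior_eq_empty
    ((U₁.isSemialgebraic_fibre p).inter (U₂.isSemialgebraic_fibre p)) h, fun h => ?_⟩
  by_contra hne
  exact (Measure.measure_pos_of_nonempty_interior volume (nonempty_iff_ne_empty.2 hne)).ne' h

end SoloInformedPTerm

/-- The bounded (1a) move over `k` from its side conditions read on base changes to `ℝ`.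
[cite: KontsevichZagier2001, §1.2 rule (1)] -/
theorem soloInformed_mem_bddDomainAddRel_of_baseChange {k : Type*} [CommRing k] [Algebra k ℝ]
    {n : ℕ} {x y z : KZOver.IntegralRep k n} {A A₁ A₂ : KZOver.IntegralRep ℝ n}
    (hx : x.baseChange ℝ = A) (hy : y.baseChange ℝ = A₁) (hz : z.baseChange ℝ = A₂)
    (hA : SoloInformedBddRep A) (hA₁ : SoloInformedBddRep A₁) (hA₂ : SoloInformedBddRep A₂)
    (hd : A.domain = A₁.domain ∪ A₂.domain) (h0 : volume (A₁.domain ∩ A₂.domain) = 0)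
    (he₁ : EqOn A.integrand A₁.integrand A₁.domain)
    (he₂ : EqOn A.integrand A₂.integrand A₂.domain) :
    KZOver.of x - KZOver.of y - KZOver.of z ∈ soloInformedBddDomainAddRel k := by
  subst hx hy hz
  exact ⟨n, x, y, z, hA, hA₁, hA₂, hd, h0, he₁, he₂, rfl⟩

/-- **Definability of the bounded domain-additivity move (1a).**
[cite: KontsevichZagier2001, §1.2 rule (1)] -/
theorem soloInformed_definableRel_of_mem_bddDomainAddRel {c : KZOver.FormalRep ℝ}
    (hc : c ∈ soloInformedBddDomainAddRel ℝ) : SoloInformedDefinableRel c := by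
  classical
  obtain ⟨n, r, r₁, r₂, hr, hr₁, hr₂, hd, h0, he₁, he₂, rfl⟩ := hc
  obtain ⟨K₀, _, T₀, p₀, hA₀, hrep₀, -⟩ := soloInformed_exists_pterm_rep r hr
  obtain ⟨K₁, _, T₁, p₁, hA₁, hrep₁, -⟩ := soloInformed_exists_pterm_rep r₁ hr₁
  obtain ⟨K₂, _, T₂, p₂, hA₂, hrep₂, -⟩ := soloInformed_exists_pterm_rep r₂ hr₂
  -- common parameter space
  let θ₀ : K₀ → (K₀ ⊕ K₁) ⊕ K₂ := fun i => Sum.inl (Sum.inl i)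
  let θ₁ : K₁ → (K₀ ⊕ K₁) ⊕ K₂ := fun i => Sum.inl (Sum.inr i)
  let θ₂ : K₂ → (K₀ ⊕ K₁) ⊕ K₂ := Sum.inr
  let T := T₀.pullback θ₀
  let U₁ := T₁.pullback θ₁
  let U₂ := T₂.pullback θ₂
  let q : (K₀ ⊕ K₁) ⊕ K₂ → ℝ := Sum.elim (Sum.elim p₀ p₁) p₂
  have hq₀ : q ∘ θ₀ = p₀ := rfl
  have hq₁ : q ∘ θ₁ = p₁ := rfl
  have hq₂ : q ∘ θ₂ = p₂ := Sum.elim_comp_inr _ _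
  have hTrep : ∀ p, T.rep p = T₀.rep (p ∘ θ₀) := fun p => SoloInformedPTerm.rep_pullback _ _ _
  have hU₁rep : ∀ p, U₁.rep p = T₁.rep (p ∘ θ₁) := fun p => SoloInformedPTerm.rep_pullback _ _ _
  have hU₂rep : ∀ p, U₂.rep p = T₂.rep (p ∘ θ₂) := fun p => SoloInformedPTerm.rep_pullback _ _ _
  have hTadm : ∀ p, T.SoloInformedAdm p ↔ T₀.SoloInformedAdm (p ∘ θ₀) := fun p =>
    SoloInformedPTerm.adm_pullback_iff _ _ _
  have hU₁adm : ∀ p, U₁.SoloInformedAdm p ↔ T₁.SoloInformedAdm (p ∘ θ₁) := fun p =>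
    SoloInformedPTerm.adm_pullback_iff _ _ _
  have hU₂adm : ∀ p, U₂.SoloInformedAdm p ↔ T₂.SoloInformedAdm (p ∘ θ₂) := fun p =>
    SoloInformedPTerm.adm_pullback_iff _ _ _
  -- the good set
  let V : Set ((K₀ ⊕ K₁) ⊕ K₂ → ℝ) := {p | T.SoloInformedAdm p ∧ U₁.SoloInformedAdm p ∧
    U₂.SoloInformedAdm p ∧ T.fibre p = U₁.fibre p ∪ U₂.fibre p ∧
    SoloInformedPTerm.SoloInformedThinPair U₁ U₂ p ∧
    SoloInformedPTerm.SoloInformedSubClause T U₁ p ∧ SoloInformedPTerm.SoloInformedSubClause T U₂ p}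
  have hV : IsSemialgebraic ℚ V :=
    soloInformed_isSemialgebraic_setOf_and T.isSemialgebraic_setOf_adm
      (soloInformed_isSemialgebraic_setOf_and U₁.isSemialgebraic_setOf_adm
      (soloInformed_isSemialgebraic_setOf_and U₂.isSemialgebraic_setOf_adm
      (soloInformed_isSemialgebraic_setOf_and
        (SoloInformedPTerm.isSemialgebraic_setOf_fibre_eq_union _ _ _)
      (soloInformed_isSemialgebraic_setOf_and
        (SoloInformedPTerm.isSemialgebraic_setOf_thinPair _ _)
      (soloInformed_isSemialgebraic_setOf_and (SoloInformedPTerm.isSemialgebraic_setOf_subClause _ _)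
      (SoloInformedPTerm.isSemialgebraic_setOf_subClause _ _))))))
  -- side conditions on `V`
  have hside : ∀ p ∈ V, (T.rep p).domain = (U₁.rep p).domain ∪ (U₂.rep p).domain ∧
      volume ((U₁.rep p).domain ∩ (U₂.rep p).domain) = 0 ∧
      EqOn (T.rep p).integrand (U₁.rep p).integrand (U₁.rep p).domain ∧
      EqOn (T.rep p).integrand (U₂.rep p).integrand (U₂.rep p).domain := by
    rintro p ⟨hT, h₁, h₂, hu, hth, hc₁, hc₂⟩
    rw [SoloInformedPTerm.rep_domain hT, SoloInformedPTerm.rep_domain h₁,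
      SoloInformedPTerm.rep_domain h₂, SoloInformedPTerm.rep_integrand hT,
      SoloInformedPTerm.rep_integrand h₁, SoloInformedPTerm.rep_integrand h₂]
    refine ⟨hu, SoloInformedPTerm.thinPair_iff_volume_eq_zero.1 hth, fun x hx => ?_,
      fun x hx => ?_⟩
    · have hxT : x ∈ T.fibre p := hu ▸ Or.inl hx
      rw [SoloInformedPTerm.hybrid_of_mem hxT, SoloInformedPTerm.hybrid_of_mem hx]
      exact SoloInformedPTerm.gval_eq_of_subClause hc₁ hT.1 h₁.1 hxT hx
    · have hxT : x ∈ T.fibre p := hu ▸ Or.inr hx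
      rw [SoloInformedPTerm.hybrid_of_mem hxT, SoloInformedPTerm.hybrid_of_mem hx]
      exact SoloInformedPTerm.gval_eq_of_subClause hc₂ hT.1 h₂.1 hxT hx
  refine ⟨(K₀ ⊕ K₁) ⊕ K₂, inferInstance, SoloInformedPCombo.three T U₁ U₂, q, V, hV, ?_, ?_, ?_, ?_⟩
  · -- the original parameter is good
    have hT : T.SoloInformedAdm q := (hTadm q).2 (hq₀ ▸ hA₀)
    have h₁ : U₁.SoloInformedAdm q := (hU₁adm q).2 (hq₁ ▸ hA₁)
    have h₂ : U₂.SoloInformedAdm q := (hU₂adm q).2 (hq₂ ▸ hA₂)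
    have hTq : T.rep q = r := by rw [hTrep, hq₀, hrep₀]
    have h₁q : U₁.rep q = r₁ := by rw [hU₁rep, hq₁, hrep₁]
    have h₂q : U₂.rep q = r₂ := by rw [hU₂rep, hq₂, hrep₂]
    have hfT : T.fibre q = r.domain := by rw [← SoloInformedPTerm.rep_domain hT, hTq]
    have hf₁ : U₁.fibre q = r₁.domain := by rw [← SoloInformedPTerm.rep_domain h₁, h₁q]
    have hf₂ : U₂.fibre q = r₂.domain := by rw [← SoloInformedPTerm.rep_domain h₂, h₂q]
    refine ⟨hT, h₁, h₂, by rw [hfT, hf₁, hf₂, hd], ?_, ?_, ?_⟩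
    · exact SoloInformedPTerm.thinPair_iff_volume_eq_zero.2 (by rw [hf₁, hf₂]; exact h0)
    · refine SoloInformedPTerm.subClause_of_graphs (g := r.integrand) (gU := r₁.integrand)
        (fun x hx t => ?_) (fun x hx t => ?_) (fun x hx => he₁ (hf₁ ▸ hx))
      · rw [SoloInformedPTerm.snoc_mem_gfibre_iff_of_adm hT
          (hfT.symm ▸ hd.symm ▸ Or.inl (hf₁ ▸ hx)), hTq]
      · rw [SoloInformedPTerm.snoc_mem_gfibre_iff_of_adm h₁ hx, h₁q]
    · refine SoloInformedPTerm.subClause_of_graphs (g := r.integrand) (gU := r₂.integrand)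
        (fun x hx t => ?_) (fun x hx t => ?_) (fun x hx => he₂ (hf₂ ▸ hx))
      · rw [SoloInformedPTerm.snoc_mem_gfibre_iff_of_adm hT
          (hfT.symm ▸ hd.symm ▸ Or.inr (hf₂ ▸ hx)), hTq]
      · rw [SoloInformedPTerm.snoc_mem_gfibre_iff_of_adm h₂ hx, h₂q]
  · -- it denotes `c`
    rw [SoloInformedPCombo.combo_three, hTrep, hU₁rep, hU₂rep, hq₀, hq₁, hq₂, hrep₀, hrep₁, hrep₂]
  · -- every good parameter denotes a bounded (1a) move over `ℝ`
    rintro p hp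
    obtain ⟨hd', h0', he₁', he₂'⟩ := hside p hp
    obtain ⟨hT, h₁, h₂, -⟩ := hp
    refine ⟨SoloInformedPCombo.adm_three hT h₁ h₂, ?_⟩
    rw [SoloInformedPCombo.combo_three]
    exact soloInformed_mem_relationsBdd_of_mem_generators (Or.inl (Or.inl (Or.inl
      (soloInformed_mem_bddDomainAddRel_of_baseChange (soloInformed_baseChange_real _)
        (soloInformed_baseChange_real _) (soloInformed_baseChange_real _)
        (SoloInformedPTerm.bddRep_rep hT) (SoloInformedPTerm.bddRep_rep h₁)
        (SoloInformedPTerm.bddRep_rep h₂) hd' h0' he₁' he₂'))))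
  · -- rational lift at parameters with rational fibres
    rintro p hp hRF
    obtain ⟨hd', h0', he₁', he₂'⟩ := hside p hp
    obtain ⟨hT, h₁, h₂, -⟩ := hp
    obtain ⟨hS₀, hG₀⟩ := soloInformedRatFibres.fibre hRF T
    obtain ⟨hS₁, hG₁⟩ := soloInformedRatFibres.fibre hRF U₁
    obtain ⟨hS₂, hG₂⟩ := soloInformedRatFibres.fibre hRF U₂
    refine SoloInformedPCombo.ratLift_three (SoloInformedPTerm.ratRep hS₀ hG₀ hT)
      (SoloInformedPTerm.ratRep hS₁ hG₁ h₁) (SoloInformedPTerm.ratRep hS₂ hG₂ h₂)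
      (SoloInformedPTerm.baseChange_ratRep _ _ _) (SoloInformedPTerm.baseChange_ratRep _ _ _)
      (SoloInformedPTerm.baseChange_ratRep _ _ _) ?_
    exact soloInformed_mem_relationsBdd_of_mem_generators (Or.inl (Or.inl (Or.inl
      (soloInformed_mem_bddDomainAddRel_of_baseChange
        (SoloInformedPTerm.baseChange_ratRep _ _ _) (SoloInformedPTerm.baseChange_ratRep _ _ _)
        (SoloInformedPTerm.baseChange_ratRep _ _ _)
        (SoloInformedPTerm.bddRep_rep hT) (SoloInformedPTerm.bddRep_rep h₁)
        (SoloInformedPTerm.bddRep_rep h₂) hd' h0' he₁' he₂'))))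

/-- **The (1a) hypothesis of THEOREM R / T, discharged.** [cite: KontsevichZagier2001, §1.2] -/
theorem soloInformed_definableRel_bddDomainAddRel :
    ∀ c ∈ soloInformedBddDomainAddRel ℝ, SoloInformedDefinableRel c :=
  fun _ hc => soloInformed_definableRel_of_mem_bddDomainAddRel hc

end Summit.KontsevichZagierPeriods.KontsevichZagierPeriods.Theorems
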